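import Literature.Geometry.Symplectic.JPlanePencilLocalFamily
import Mathlib.Analysis.Complex.Schwarz
import Mathlib.Topology.MetricSpace.Contracting
import HarnessLib

/-!
# Pencil members in the standard flat end, II: canonical parametrisation, transversality and the
# compactification data at `q_a` (proved part of Wendl, Prop. 2.53 with `m = 1`)

Companion ("Proofs") file of `JPlanePencilLocalFamily.lean`, whose named fact
`Literature.Geometry.Symplectic.jPlanePencil_localFamily_homotopySphere` (Wendl, LNM 2216,
Prop. 2.53 with `m = 1`, Thm 2.46, Thm 2.11, Thm 2.49, in the "pencil of `J`-planes through one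
point at infinity" form) is NOT discharged here: its proof is the non-linear Fredholm theory of the
normal Cauchy–Riemann operator of an embedded `J`-sphere (Wendl 2018, §2.1–2.2), which has no
vocabulary in Mathlib or in the tree. The fact file itself already proves step L1 of the translation
between the plane formulation and the printed sphere formulation (`flatCx`, `flatI`,
`differentiableAt_pencilCoord_comp`: a member is holomorphic in the flat coordinates of the end;
`IsPencilPlane.tendsto_nhds`, `IsPencilPlane.eventually_inPuncturedChartBall`: end confinement;
`IsPencilPlane.exists_differentiableOn_pencilCoord`). This file continues with the next proved
steps, all read off the asymptotics `z(u ξ) − ξ → 0`, `w(u ξ) → b` of a member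
`u : ℂ → M ∖ p` of intercept `b` (`IsPencilPlane J u b`) and holomorphy in the end
(Wendl 2018, proof sketch of Prop. 2.53, p. 65; Gromov 1985, 2.4.A′):

* §1 complements on the flat coordinates: `‖flatCx y‖`-vs-`‖y‖` estimates, the explicit chain rule
  `d(pencilCoord ∘ u)(ξ) = flatCx ∘ Dψ(u ξ) ∘ du(ξ)` (`hasMFDerivAt_pencilCoord_comp`,
  `fderiv_pencilCoord_comp_apply`) and its complex linearity (`fderiv_pencilCoord_comp_mul_I`,
  `flatCx_dpsi_J`: "`J` standard" reads `Dψ ∘ J = i ∘ Dψ`), the open-set form of holomorphy in the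
  end (`differentiableOn_pencilCoord_comp`);
* §2 filter-level API of members (`IsPencilPlane.tendsto_cocompact`, `tendsto_extChartAt`,
  `tendsto_norm_fst`: `‖z(u ξ)‖ → ∞`, `tendsto_fst_div_self`: `z(u ξ)/ξ → 1`) and
  **uniqueness of the intercept** (`IsPencilPlane.intercept_unique`);
* §3 **rigidity of the canonical parametrisation**: the only affine reparametrisation `ξ ↦ a ξ + c`
  of a member which is again a member (of any intercept) is the identity
  (`IsPencilPlane.affine_eq_id`, `IsPencilPlane.comp_affine_eq_self`): embedded `Ĵ`-spheres through
  `q_a` are taken up to `Aut(S², ∞) = Aff(ℂ)` and `z(u ξ) − ξ → 0` is the slice fixing the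
  parametrisation (Wendl 2018, §2.1.3–2.1.4);
* §4 **transversality to the line at infinity**: `deriv (z ∘ u) → 1` at infinity
  (`IsPencilPlane.tendsto_deriv_fst`, Cauchy's estimate for `z(u ξ) − ξ` on the discs
  `B(ξ, ‖ξ‖/2)`), and **the compactification at `q_a`**: in the parameter `η = 1/ξ` at `∞ ∈ S²` and
  the chart `(X, W) = (1/z, w/z)` at `q_a = [1:0:0]` of the line at infinity, the functions
  `X(û η) = 1/z(u η⁻¹)`, `W(û η) = w(u η⁻¹)/z(u η⁻¹)` (value `0` at `η = 0`, i.e. `û(∞) = q_a`) have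
  complex derivatives `1` and `b` at `0` (`IsPencilPlane.hasDerivAt_inv_fst_zero`,
  `IsPencilPlane.hasDerivAt_snd_div_fst_zero`) and are holomorphic on a disc about `0`
  (`IsPencilPlane.exists_differentiableOn_compactification`). So a member closes up to a
  holomorphic curve through `q_a`, immersed there and tangent to the line `{w = b}`, meeting `ℓ∞`
  transversally once — the object `û ∈ 𝓜_{0,1}(Ĵ; q_a)` with `û · ℓ∞ = 1` to which Prop. 2.53 is
  applied, short of the (unavailable) glued manifold `X̂ ≅ M # ℂP²` itself;
* §5 **the graph normal form near infinity** (`IsPencilPlane.exists_graph_normalForm`): there are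
  `R` and `H : ℂ → ℂ` holomorphic on `{R < ‖z‖}` with `H → b` at `∞` such that the far part of the
  member is the graph `w = H(z)` over the `z`-plane — `z ∘ u` is injective on `{R − 1 ≤ ‖ξ‖}`
  (mean-value inequality with `‖(z ∘ u − id)'‖ ≤ 1/2`, `IsPencilPlane.exists_good_radius`,
  `injOn_fst_of_good_radius`), every far vertical line `{z = z₀}` is hit
  (`exists_fst_eq_of_good_radius`: Banach fixed point for `ξ ↦ z₀ − (z(u ξ) − ξ)` on the closed unit
  disc about `z₀`), and the inverse is holomorphic (`HasDerivAt.of_local_left_inverse`);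
* §6 **far vertical lines meet the member exactly once** among points of the chart domain
  (`IsPencilPlane.exists_unique_fst_eq`; the junk values of `pencilCoord` outside the chart source
  are excluded), using that a compact subset of `M ∖ {p}` stays away from `p` in the chart
  (`exists_pos_le_norm_extChartAt_sub_of_isCompact`) — Gromov's reading of the pencil in the end,
  "each far line meets the curve in one point" (1985, 2.4.A′).

Everything in this file is PROVED; no definition and no named fact is introduced. What remains for
the discharge of the fact is recorded in its docstring: the Fredholm/implicit-function theory of
the normal Cauchy–Riemann operator (existence and smoothness of the family, Wendl Thm 2.11/2.46),
the zero count `c₁(N_û) = [û]·[û] = 1` (where the homotopy-sphere hypothesis enters), and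
positivity of intersections (Thm 2.49) for the universality clause.

## References

* C. Wendl, *Holomorphic Curves in Low Dimensions*, Lecture Notes in Math. 2216, Springer (2018),
  Prop. 2.53 and its proof sketch, pp. 64–66; §2.1.4 (constrained moduli spaces). [Wendl2018]
* M. Gromov, *Pseudo holomorphic curves in symplectic manifolds*, Invent. Math. 82 (1985),
  2.4.A′. [Gromov1985]
* C. Hummel, *Gromov's Compactness Theorem for Pseudo-holomorphic Curves*, Progress in Math. 151
  (1997), Ch. I §3, eq. (3.1). [Hummel1997]
-/

noncomputable section

open scoped Manifold ContDiff Topology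
open Set Filter

namespace Literature.Geometry.Symplectic

/-! ### §1 Complements on the flat coordinates -/

section LinearAlgebra

/-- `‖(flatCx y).1‖² + ‖(flatCx y).2‖² = ‖y‖²`: the coordinate change `ℝ⁴ → ℂ²` is an isometry
for the `ℓ²`-norms. [folklore] -/
theorem norm_sq_flatCx_fst_add (y : EuclideanSpace ℝ (Fin 4)) :
    ‖(flatCx y).1‖ ^ 2 + ‖(flatCx y).2‖ ^ 2 = ‖y‖ ^ 2 := by
  rw [EuclideanSpace.norm_eq, Real.sq_sqrt (Finset.sum_nonneg fun i _ => sq_nonneg _),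
    Fin.sum_univ_four, flatCx_apply, Complex.sq_norm, Complex.sq_norm, Complex.normSq_apply,
    Complex.normSq_apply]
  simp only [Real.norm_eq_abs, sq_abs]
  ring

/-- `‖(flatCx y).1‖ ≤ ‖y‖`. [folklore] -/
theorem norm_flatCx_fst_le (y : EuclideanSpace ℝ (Fin 4)) : ‖(flatCx y).1‖ ≤ ‖y‖ := by
  have h := norm_sq_flatCx_fst_add y
  nlinarith [norm_nonneg y, norm_nonneg (flatCx y).1, norm_nonneg (flatCx y).2]

/-- `‖(flatCx y).2‖ ≤ ‖y‖`. [folklore] -/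
theorem norm_flatCx_snd_le (y : EuclideanSpace ℝ (Fin 4)) : ‖(flatCx y).2‖ ≤ ‖y‖ := by
  have h := norm_sq_flatCx_fst_add y
  nlinarith [norm_nonneg y, norm_nonneg (flatCx y).1, norm_nonneg (flatCx y).2]

/-- `‖y‖ ≤ ‖(flatCx y).1‖ + ‖(flatCx y).2‖`. [folklore] -/
theorem norm_le_norm_flatCx_fst_add (y : EuclideanSpace ℝ (Fin 4)) :
    ‖y‖ ≤ ‖(flatCx y).1‖ + ‖(flatCx y).2‖ := by
  have h := norm_sq_flatCx_fst_add y
  nlinarith [norm_nonneg y, norm_nonneg (flatCx y).1, norm_nonneg (flatCx y).2]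

end LinearAlgebra

section End

variable {M : Type*} [TopologicalSpace M] [T2Space M] [ChartedSpace (EuclideanSpace ℝ (Fin 4)) M]

/-- On the punctured `ε`-chart-ball the flat coordinate has norm `> ε⁻¹`:
`‖ι (e x − e p)‖ = ‖e x − e p‖⁻¹ > ε⁻¹`. [folklore] -/
theorem inv_lt_norm_inversion_of_inPuncturedChartBall (p : M) {ε : ℝ} {x : punctured p}
    (hx : InPuncturedChartBall p ε x) :
    ε⁻¹ < ‖inversion (extChartAt (𝓡 4) p x.1 - extChartAt (𝓡 4) p p)‖ := by
  have hne := extChartAt_sub_ne_zero x hx.1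
  have hlt : ‖extChartAt (𝓡 4) p x.1 - extChartAt (𝓡 4) p p‖ < ε := by
    rw [← dist_eq_norm]; exact hx.2
  rw [norm_inversion]
  exact (inv_lt_inv₀ (lt_of_le_of_lt (norm_nonneg _) hlt) (norm_pos_iff.2 hne)).2 hlt

variable [IsManifold (𝓡 4) ∞ M]

/-- **Chain rule for the flat coordinates** `ψ = ι ∘ (e − e p)` on `M ∖ {p}`: at a point of the
punctured chart-ball, `ψ` is differentiable with `dψ_x = Dι(e x − e p) ∘ D(e ∘ val)_x`. [folklore] -/
theorem hasMFDerivAt_flatCoord (p : M) {ε : ℝ} {x : punctured p} (hx : InPuncturedChartBall p ε x) :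
    HasMFDerivAt (𝓡 4) 𝓘(ℝ, EuclideanSpace ℝ (Fin 4))
      (fun z : punctured p => inversion (extChartAt (𝓡 4) p z.1 - extChartAt (𝓡 4) p p)) x
      ((fderiv ℝ inversion (extChartAt (𝓡 4) p x.1 - extChartAt (𝓡 4) p p)).comp
        (mfderiv (𝓡 4) 𝓘(ℝ, EuclideanSpace ℝ (Fin 4))
          (fun z : punctured p => extChartAt (𝓡 4) p z.1) x)) := by
  have hne := extChartAt_sub_ne_zero x hx.1
  have hE : ContMDiffAt (𝓡 4) 𝓘(ℝ, EuclideanSpace ℝ (Fin 4)) ∞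
      (fun z : punctured p => extChartAt (𝓡 4) p z.1) x :=
    (contMDiffAt_extChartAt' (I := 𝓡 4) (n := ∞) hx.1).comp x
      (contMDiff_subtype_val (I := 𝓡 4) (n := ∞) (U := punctured p) x)
  have hEx : MDifferentiableAt (𝓡 4) 𝓘(ℝ, EuclideanSpace ℝ (Fin 4))
      (fun z : punctured p => extChartAt (𝓡 4) p z.1) x := hE.mdifferentiableAt (by simp)
  have hg : HasFDerivAt
      (fun y : EuclideanSpace ℝ (Fin 4) => inversion (y - extChartAt (𝓡 4) p p))
      (fderiv ℝ inversion (extChartAt (𝓡 4) p x.1 - extChartAt (𝓡 4) p p))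
      (extChartAt (𝓡 4) p x.1) := by
    have h1 : HasFDerivAt inversion
        (fderiv ℝ inversion (extChartAt (𝓡 4) p x.1 - extChartAt (𝓡 4) p p))
        (extChartAt (𝓡 4) p x.1 - extChartAt (𝓡 4) p p) :=
      (differentiableAt_inversion hne).hasFDerivAt
    have h2 := h1.comp (extChartAt (𝓡 4) p x.1) (hasFDerivAt_sub_const (extChartAt (𝓡 4) p p))
    rwa [ContinuousLinearMap.comp_id] at h2
  exact HasMFDerivAt.comp x
    (g := fun y : EuclideanSpace ℝ (Fin 4) => inversion (y - extChartAt (𝓡 4) p p))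
    (f := fun z : punctured p => extChartAt (𝓡 4) p z.1) hg.hasMFDerivAt hEx.hasMFDerivAt

variable {p : M} {ε : ℝ}
  {J : ∀ x : punctured p, TangentSpace (𝓡 4) x →L[ℝ] TangentSpace (𝓡 4) x} {u : ℂ → punctured p}
  {ξ : ℂ}

omit [IsManifold (𝓡 4) ∞ M] in
/-- **Standardness in complex coordinates.** If `J` is standard on the punctured `ε`-chart-ball
(`⟪Dψ(J v), c⟫ = ω₀(Dψ v, c)`, the hypothesis of the fact), then
`flatCx (Dψ (J v)) = i • flatCx (Dψ v)` there: in the coordinates `pencilCoord` the structure `J`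
is multiplication by `i`. [cite: Gromov1985, 2.4.A'] -/
theorem flatCx_dpsi_J
    (hJstd : ∀ x : punctured p, InPuncturedChartBall p ε x →
      ∀ (v : TangentSpace (𝓡 4) x) (c : EuclideanSpace ℝ (Fin 4)),
        inner ℝ (fderiv ℝ inversion (extChartAt (𝓡 4) p x.1 - extChartAt (𝓡 4) p p)
          (mfderiv (𝓡 4) 𝓘(ℝ, EuclideanSpace ℝ (Fin 4))
            (fun z : punctured p => extChartAt (𝓡 4) p z.1) x (J x v))) c
        = stdSymplecticForm (fderiv ℝ inversion (extChartAt (𝓡 4) p x.1 - extChartAt (𝓡 4) p p)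
          (mfderiv (𝓡 4) 𝓘(ℝ, EuclideanSpace ℝ (Fin 4))
            (fun z : punctured p => extChartAt (𝓡 4) p z.1) x v)) c)
    {x : punctured p} (hx : InPuncturedChartBall p ε x) (v : TangentSpace (𝓡 4) x) :
    flatCx (fderiv ℝ inversion (extChartAt (𝓡 4) p x.1 - extChartAt (𝓡 4) p p)
        (mfderiv (𝓡 4) 𝓘(ℝ, EuclideanSpace ℝ (Fin 4))
          (fun z : punctured p => extChartAt (𝓡 4) p z.1) x (J x v))) =
      Complex.I • flatCx (fderiv ℝ inversion (extChartAt (𝓡 4) p x.1 - extChartAt (𝓡 4) p p)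
        (mfderiv (𝓡 4) 𝓘(ℝ, EuclideanSpace ℝ (Fin 4))
          (fun z : punctured p => extChartAt (𝓡 4) p z.1) x v)) := by
  rw [eq_flatI_of_inner_eq_stdSymplecticForm (hJstd x hx v), flatCx_flatI]

/-- **Chain rule in the flat end.** Along a map `u : ℂ → M ∖ p` differentiable at `ξ` with
`u ξ` in the punctured chart-ball, `pencilCoord p ∘ u` has the (manifold) derivative
`flatCx ∘ Dψ(u ξ) ∘ du(ξ)`. [folklore] -/
theorem hasMFDerivAt_pencilCoord_comp (hu : MDifferentiableAt 𝓘(ℝ, ℂ) (𝓡 4) u ξ)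
    (hx : InPuncturedChartBall p ε (u ξ)) :
    HasMFDerivAt 𝓘(ℝ, ℂ) 𝓘(ℝ, ℂ × ℂ) (fun ξ : ℂ => pencilCoord p (u ξ)) ξ
      ((flatCx : EuclideanSpace ℝ (Fin 4) →L[ℝ] ℂ × ℂ).comp
        (((fderiv ℝ inversion (extChartAt (𝓡 4) p (u ξ).1 - extChartAt (𝓡 4) p p)).comp
          (mfderiv (𝓡 4) 𝓘(ℝ, EuclideanSpace ℝ (Fin 4))
            (fun z : punctured p => extChartAt (𝓡 4) p z.1) (u ξ))).comp
          (mfderiv 𝓘(ℝ, ℂ) (𝓡 4) u ξ))) := by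
  have hψ := hasMFDerivAt_flatCoord p hx
  have hc : HasMFDerivAt 𝓘(ℝ, EuclideanSpace ℝ (Fin 4)) 𝓘(ℝ, ℂ × ℂ)
      (flatCx : EuclideanSpace ℝ (Fin 4) → ℂ × ℂ)
      (inversion (extChartAt (𝓡 4) p (u ξ).1 - extChartAt (𝓡 4) p p))
      (flatCx : EuclideanSpace ℝ (Fin 4) →L[ℝ] ℂ × ℂ) :=
    hasMFDerivAt_iff_hasFDerivAt.2 flatCx.hasFDerivAt
  exact hc.comp ξ (hψ.comp ξ hu.hasMFDerivAt)

/-- Pointwise form for the Fréchet derivative (`mfderiv = fderiv` between vector spaces):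
`d(pencilCoord ∘ u)(ξ) ζ = flatCx (Dψ(u ξ) (du(ξ) ζ))`. [folklore] -/
theorem fderiv_pencilCoord_comp_apply (hu : MDifferentiableAt 𝓘(ℝ, ℂ) (𝓡 4) u ξ)
    (hx : InPuncturedChartBall p ε (u ξ)) (ζ : ℂ) :
    fderiv ℝ (fun ξ : ℂ => pencilCoord p (u ξ)) ξ ζ =
      flatCx (fderiv ℝ inversion (extChartAt (𝓡 4) p (u ξ).1 - extChartAt (𝓡 4) p p)
        (mfderiv (𝓡 4) 𝓘(ℝ, EuclideanSpace ℝ (Fin 4))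
          (fun z : punctured p => extChartAt (𝓡 4) p z.1) (u ξ) (mfderiv 𝓘(ℝ, ℂ) (𝓡 4) u ξ ζ))) := by
  have h := (hasMFDerivAt_pencilCoord_comp hu hx).mfderiv
  rw [mfderiv_eq_fderiv] at h
  exact DFunLike.congr_fun h ζ

/-- `pencilCoord ∘ u` is real differentiable at such a point. [folklore] -/
theorem differentiableAt_real_pencilCoord_comp (hu : MDifferentiableAt 𝓘(ℝ, ℂ) (𝓡 4) u ξ)
    (hx : InPuncturedChartBall p ε (u ξ)) :
    DifferentiableAt ℝ (fun ξ : ℂ => pencilCoord p (u ξ)) ξ :=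
  (hasMFDerivAt_pencilCoord_comp hu hx).mdifferentiableAt.differentiableAt

/-- **Holomorphy in the end, derivative form** (Hummel 1997, Ch. I §3: in complex coordinates
`du ∘ i = J ∘ du` is the Cauchy–Riemann system). For `J` standard on the punctured `ε`-chart-ball
at `p` and `u` `J`-holomorphic and differentiable at `ξ` with `u ξ` in that ball, the real
derivative of `pencilCoord p ∘ u` at `ξ` commutes with `i`. [cite: Hummel1997, Ch. I §3, eq. (3.1)] -/
theorem fderiv_pencilCoord_comp_mul_I
    (hJstd : ∀ x : punctured p, InPuncturedChartBall p ε x →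
      ∀ (v : TangentSpace (𝓡 4) x) (c : EuclideanSpace ℝ (Fin 4)),
        inner ℝ (fderiv ℝ inversion (extChartAt (𝓡 4) p x.1 - extChartAt (𝓡 4) p p)
          (mfderiv (𝓡 4) 𝓘(ℝ, EuclideanSpace ℝ (Fin 4))
            (fun z : punctured p => extChartAt (𝓡 4) p z.1) x (J x v))) c
        = stdSymplecticForm (fderiv ℝ inversion (extChartAt (𝓡 4) p x.1 - extChartAt (𝓡 4) p p)
          (mfderiv (𝓡 4) 𝓘(ℝ, EuclideanSpace ℝ (Fin 4))
            (fun z : punctured p => extChartAt (𝓡 4) p z.1) x v)) c)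
    (hhol : IsJHolomorphic (𝓡 4) J u) (hu : MDifferentiableAt 𝓘(ℝ, ℂ) (𝓡 4) u ξ)
    (hx : InPuncturedChartBall p ε (u ξ)) (ζ : ℂ) :
    fderiv ℝ (fun ξ : ℂ => pencilCoord p (u ξ)) ξ (Complex.I * ζ) =
      Complex.I • fderiv ℝ (fun ξ : ℂ => pencilCoord p (u ξ)) ξ ζ := by
  rw [fderiv_pencilCoord_comp_apply hu hx, fderiv_pencilCoord_comp_apply hu hx, hhol ξ ζ,
    flatCx_dpsi_J hJstd hx]

/-- **Holomorphy in the end, open-set form**: for `J` standard on the punctured `ε`-chart-ball and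
a `C^∞` `J`-holomorphic `u`, `pencilCoord p ∘ u` is holomorphic on the open set `u⁻¹(B_ε)`
(pointwise this is `differentiableAt_pencilCoord_comp` of the fact file; the set is open for
continuous `u` by `isOpen_setOf_inPuncturedChartBall` of `GromovR4StdModel.lean`).
[cite: Hummel1997, Ch. I §3, eq. (3.1)] -/
theorem differentiableOn_pencilCoord_comp
    (hJstd : ∀ x : punctured p, InPuncturedChartBall p ε x →
      ∀ (v : TangentSpace (𝓡 4) x) (c : EuclideanSpace ℝ (Fin 4)),
        inner ℝ (fderiv ℝ inversion (extChartAt (𝓡 4) p x.1 - extChartAt (𝓡 4) p p)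
          (mfderiv (𝓡 4) 𝓘(ℝ, EuclideanSpace ℝ (Fin 4))
            (fun z : punctured p => extChartAt (𝓡 4) p z.1) x (J x v))) c
        = stdSymplecticForm (fderiv ℝ inversion (extChartAt (𝓡 4) p x.1 - extChartAt (𝓡 4) p p)
          (mfderiv (𝓡 4) 𝓘(ℝ, EuclideanSpace ℝ (Fin 4))
            (fun z : punctured p => extChartAt (𝓡 4) p z.1) x v)) c)
    (hhol : IsJHolomorphic (𝓡 4) J u) (hu : ContMDiff 𝓘(ℝ, ℂ) (𝓡 4) ∞ u) :
    DifferentiableOn ℂ (fun ξ : ℂ => pencilCoord p (u ξ)) {ξ : ℂ | InPuncturedChartBall p ε (u ξ)} :=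
  fun ξ hξ =>
    (differentiableAt_pencilCoord_comp (hu ξ) (hhol ξ) hξ.1 (hJstd (u ξ) hξ)).differentiableWithinAt

end End

/-! ### §2 Pencil members: filter-level API and uniqueness of the intercept -/

section Members

variable {M : Type*} [TopologicalSpace M] [T2Space M] [ChartedSpace (EuclideanSpace ℝ (Fin 4)) M]
  {p : M} {ε : ℝ}
  {J : ∀ x : punctured p, TangentSpace (𝓡 4) x →L[ℝ] TangentSpace (𝓡 4) x} {u : ℂ → punctured p}
  {b : ℂ}

/-- On `ℂ` an eventual property along `cocompact ℂ` holds outside a large ball. [folklore] -/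
theorem exists_forall_norm_le_of_eventually_cocompact {P : ℂ → Prop}
    (h : ∀ᶠ ξ in cocompact ℂ, P ξ) : ∃ r : ℝ, ∀ ξ : ℂ, r ≤ ‖ξ‖ → P ξ := by
  rw [← Metric.cobounded_eq_cocompact,
    (Filter.hasBasis_cobounded_norm (E := ℂ)).eventually_iff] at h
  obtain ⟨r, -, hr⟩ := h
  exact ⟨r, fun ξ hξ => hr hξ⟩

/-- From a statement outside a ball to an eventual statement along `cocompact ℂ`. [folklore] -/
theorem eventually_cocompact_of_forall_norm_le {P : ℂ → Prop} {T : ℝ}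
    (h : ∀ ξ : ℂ, T ≤ ‖ξ‖ → P ξ) : ∀ᶠ ξ in cocompact ℂ, P ξ := by
  rw [← Metric.cobounded_eq_cocompact]
  exact (eventually_cobounded_le_norm T).mono h

/-- The affine map `ξ ↦ a ξ + c`, `a ≠ 0`, is proper: it tends to `cocompact ℂ` along
`cocompact ℂ`. [folklore] -/
theorem tendsto_affine_cocompact {a : ℂ} (ha : a ≠ 0) (c : ℂ) :
    Tendsto (fun ξ : ℂ => a * ξ + c) (cocompact ℂ) (cocompact ℂ) := by
  rw [← Metric.cobounded_eq_cocompact, ← tendsto_norm_atTop_iff_cobounded]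
  have h1 : Tendsto (fun ξ : ℂ => ‖a‖ * ‖ξ‖ + -‖c‖) (Bornology.cobounded ℂ) atTop :=
    tendsto_atTop_add_const_right _ _
      ((tendsto_norm_cobounded_atTop (E := ℂ)).const_mul_atTop (norm_pos_iff.2 ha))
  refine tendsto_atTop_mono (fun ξ => ?_) h1
  have h2 : ‖a * ξ‖ ≤ ‖a * ξ + c‖ + ‖c‖ := by
    calc ‖a * ξ‖ = ‖(a * ξ + c) - c‖ := by rw [add_sub_cancel_right]
      _ ≤ ‖a * ξ + c‖ + ‖c‖ := norm_sub_le _ _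
  rw [norm_mul] at h2
  linarith

namespace IsPencilPlane

/-- A pencil member is a non-constant `C^∞` entire `J`-curve. [folklore] -/
theorem isEntireJCurve (h : IsPencilPlane J u b) : IsEntireJCurve (𝓡 4) J u :=
  h.1

/-- A pencil member is `C^∞`. [folklore] -/
theorem contMDiff (h : IsPencilPlane J u b) : ContMDiff 𝓘(ℝ, ℂ) (𝓡 4) ∞ u :=
  h.1.contMDiff

/-- A pencil member is continuous. [folklore] -/
theorem continuous (h : IsPencilPlane J u b) : Continuous u :=
  h.contMDiff.continuous

/-- A pencil member is differentiable at every point. [folklore] -/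
theorem mdifferentiableAt (h : IsPencilPlane J u b) (ξ : ℂ) : MDifferentiableAt 𝓘(ℝ, ℂ) (𝓡 4) u ξ :=
  (h.contMDiff ξ).mdifferentiableAt (by simp)

/-- A pencil member is `J`-holomorphic. [folklore] -/
theorem isJHolomorphic (h : IsPencilPlane J u b) : IsJHolomorphic (𝓡 4) J u :=
  h.1.isJHolomorphic

/-- A pencil member is injective. [folklore] -/
theorem injective (h : IsPencilPlane J u b) : Function.Injective u :=
  h.2.1

/-- A pencil member is immersed. [folklore] -/
theorem injective_mfderiv (h : IsPencilPlane J u b) (ξ : ℂ) :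
    Function.Injective (mfderiv 𝓘(ℝ, ℂ) (𝓡 4) u ξ) :=
  h.2.2.1 ξ

/-- The canonical parametrisation: `z(u ξ) − ξ → 0` at infinity. [folklore] -/
theorem tendsto_fst_sub (h : IsPencilPlane J u b) :
    Tendsto (fun ξ : ℂ => (pencilCoord p (u ξ)).1 - ξ) (cocompact ℂ) (𝓝 0) :=
  h.2.2.2.2.1

/-- The intercept: `w(u ξ) → b` at infinity. [folklore] -/
theorem tendsto_snd (h : IsPencilPlane J u b) :
    Tendsto (fun ξ : ℂ => (pencilCoord p (u ξ)).2) (cocompact ℂ) (𝓝 b) :=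
  h.2.2.2.2.2

/-- Properness in filter form: a member tends to the cocompact filter of `M ∖ {p}` along
`cocompact ℂ`. [folklore] -/
theorem tendsto_cocompact (h : IsPencilPlane J u b) : Tendsto u (cocompact ℂ) (cocompact (punctured p)) := by
  rw [Filter.hasBasis_cocompact.tendsto_right_iff]
  intro K hK
  exact (h.isCompact_preimage hK).compl_mem_cocompact

/-- **The intercept of a member is unique** (limits along the non-trivial filter `cocompact ℂ` are
unique). [folklore] -/
theorem intercept_unique {b' : ℂ} (h : IsPencilPlane J u b) (h' : IsPencilPlane J u b') : b = b' :=
  haveI : (cocompact ℂ).NeBot := Filter.cocompact_neBot_iff.2 inferInstance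
  tendsto_nhds_unique h.tendsto_snd h'.tendsto_snd

/-- `‖z(u ξ)‖ → ∞` at infinity (since `z(u ξ) − ξ → 0`). [folklore] -/
theorem tendsto_norm_fst (h : IsPencilPlane J u b) :
    Tendsto (fun ξ : ℂ => ‖(pencilCoord p (u ξ)).1‖) (cocompact ℂ) atTop := by
  have h1 : ∀ᶠ ξ in cocompact ℂ, ‖(pencilCoord p (u ξ)).1 - ξ‖ < 1 := by
    have := (Metric.tendsto_nhds.1 h.tendsto_fst_sub) 1 one_pos
    simpa [dist_zero_right] using this
  have h2 : Tendsto (fun ξ : ℂ => ‖ξ‖ + -1) (cocompact ℂ) atTop :=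
    tendsto_atTop_add_const_right _ _ tendsto_norm_cocompact_atTop
  refine tendsto_atTop_mono' _ ?_ h2
  filter_upwards [h1] with ξ hξ
  have h3 : ‖ξ‖ ≤ ‖(pencilCoord p (u ξ)).1‖ + ‖(pencilCoord p (u ξ)).1 - ξ‖ := by
    calc ‖ξ‖ = ‖(pencilCoord p (u ξ)).1 - ((pencilCoord p (u ξ)).1 - ξ)‖ := by rw [sub_sub_cancel]
      _ ≤ ‖(pencilCoord p (u ξ)).1‖ + ‖(pencilCoord p (u ξ)).1 - ξ‖ := norm_sub_le _ _
  linarith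

/-- **`z(u ξ)/ξ → 1` at infinity** (from `z(u ξ) − ξ → 0` and `ξ⁻¹ → 0`). [folklore] -/
theorem tendsto_fst_div_self (h : IsPencilPlane J u b) :
    Tendsto (fun ξ : ℂ => (pencilCoord p (u ξ)).1 / ξ) (cocompact ℂ) (𝓝 1) := by
  have h0 : Tendsto (fun ξ : ℂ => ξ⁻¹) (cocompact ℂ) (𝓝 0) := by
    rw [← Metric.cobounded_eq_cocompact]
    exact Filter.tendsto_inv₀_cobounded
  have h1 : Tendsto (fun ξ : ℂ => ((pencilCoord p (u ξ)).1 - ξ) * ξ⁻¹) (cocompact ℂ) (𝓝 0) := by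
    simpa using h.tendsto_fst_sub.mul h0
  have h2 : ∀ᶠ ξ in cocompact ℂ, ((pencilCoord p (u ξ)).1 - ξ) * ξ⁻¹ + 1 =
      (pencilCoord p (u ξ)).1 / ξ := by
    refine eventually_cocompact_of_forall_norm_le (T := 1) fun ξ hξ => ?_
    have hξ0 : ξ ≠ 0 := by
      rintro rfl
      norm_num at hξ
    field_simp
    ring
  have h3 : Tendsto (fun ξ : ℂ => ((pencilCoord p (u ξ)).1 - ξ) * ξ⁻¹ + 1) (cocompact ℂ) (𝓝 1) := by
    simpa using h1.add_const 1
  exact h3.congr' h2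

/-- In the chart at `p` a member tends to the image of `p` (chart-level form of
`IsPencilPlane.tendsto_nhds`). [folklore] -/
theorem tendsto_extChartAt [CompactSpace M] (h : IsPencilPlane J u b) :
    Tendsto (fun ξ : ℂ => extChartAt (𝓡 4) p (u ξ).1) (cocompact ℂ) (𝓝 (extChartAt (𝓡 4) p p)) := by
  rw [Metric.tendsto_nhds]
  intro r hr
  filter_upwards [h.eventually_inPuncturedChartBall hr] with ξ hξ
  exact hξ.2

/-- Outside a large ball a member lies in a prescribed punctured chart-ball. [folklore] -/
theorem exists_forall_norm_le_inPuncturedChartBall [CompactSpace M] (h : IsPencilPlane J u b)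
    {r : ℝ} (hr : 0 < r) : ∃ R : ℝ, ∀ ξ : ℂ, R ≤ ‖ξ‖ → InPuncturedChartBall p r (u ξ) :=
  exists_forall_norm_le_of_eventually_cocompact (h.eventually_inPuncturedChartBall hr)

/-! ### §3 Rigidity of the canonical parametrisation -/

/-- **Rigidity of the canonical parametrisation.** If `u` is a pencil member and the affine
reparametrisation `ξ ↦ u (a ξ + c)` is again a member (of any intercept), then `a = 1` and `c = 0`:
the automorphism `φ = a ξ + c` of `ℂ` satisfies `φ ξ − ξ = (z(u(φ ξ)) − ξ) − (z(u(φ ξ)) − φ ξ) → 0`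
at infinity. (Embedded `Ĵ`-spheres through `q_a` are considered up to `Aut(S², ∞) = Aff(ℂ)`;
the asymptotic condition `z(u ξ) − ξ → 0` is the slice fixing the parametrisation, Wendl 2018,
§2.1.3–2.1.4.) [cite: Wendl2018, §2.1.4 (constrained moduli spaces)] -/
theorem affine_eq_id (h : IsPencilPlane J u b) {a c b' : ℂ}
    (h' : IsPencilPlane J (u ∘ fun ξ : ℂ => a * ξ + c) b') : a = 1 ∧ c = 0 := by
  haveI : (cocompact ℂ).NeBot := Filter.cocompact_neBot_iff.2 inferInstance
  have ha : a ≠ 0 := by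
    rintro rfl
    obtain ⟨ζ, ζ', hne⟩ := h'.isEntireJCurve.exists_ne
    exact hne (by simp)
  have h1 : Tendsto (fun ξ : ℂ => (pencilCoord p (u (a * ξ + c))).1 - (a * ξ + c)) (cocompact ℂ)
      (𝓝 0) :=
    h.tendsto_fst_sub.comp (tendsto_affine_cocompact ha c)
  have h2 : Tendsto (fun ξ : ℂ => (pencilCoord p (u (a * ξ + c))).1 - ξ) (cocompact ℂ) (𝓝 0) :=
    h'.tendsto_fst_sub
  have h3 : Tendsto (fun ξ : ℂ => (a - 1) * ξ + c) (cocompact ℂ) (𝓝 0) := by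
    have h4 := h2.sub h1
    rw [sub_zero] at h4
    exact h4.congr fun ξ => by ring
  by_cases ha1 : a = 1
  · subst ha1
    refine ⟨rfl, ?_⟩
    have h5 : Tendsto (fun _ : ℂ => c) (cocompact ℂ) (𝓝 0) := h3.congr fun ξ => by ring
    exact tendsto_const_nhds_iff.1 h5
  · exfalso
    have h6 : Tendsto (fun ξ : ℂ => (a - 1) * ξ + c) (cocompact ℂ) (cocompact ℂ) :=
      tendsto_affine_cocompact (sub_ne_zero.2 ha1) c
    have e1 : ∀ᶠ ξ in cocompact ℂ, ‖(a - 1) * ξ + c‖ < 1 := by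
      have := (Metric.tendsto_nhds.1 h3) 1 one_pos
      simpa [dist_zero_right] using this
    have e2 : ∀ᶠ ξ in cocompact ℂ, 1 ≤ ‖(a - 1) * ξ + c‖ :=
      (tendsto_norm_cocompact_atTop.comp h6).eventually_ge_atTop 1
    obtain ⟨ξ, hξ1, hξ2⟩ := (e1.and e2).exists
    exact absurd hξ1 (not_lt.2 hξ2)

/-- Hence a member admits no non-trivial affine reparametrisation which is again a member:
`u ∘ (a · + c) = u`. [cite: Wendl2018, §2.1.4 (constrained moduli spaces)] -/
theorem comp_affine_eq_self (h : IsPencilPlane J u b) {a c b' : ℂ}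
    (h' : IsPencilPlane J (u ∘ fun ξ : ℂ => a * ξ + c) b') : (u ∘ fun ξ : ℂ => a * ξ + c) = u := by
  obtain ⟨rfl, rfl⟩ := h.affine_eq_id h'
  funext ξ
  simp

/-! ### §4 Transversality to the line at infinity and the compactification data at `q_a` -/

variable [CompactSpace M] [IsManifold (𝓡 4) ∞ M]

/-- **The correction `g(ξ) = z(u ξ) − ξ` has derivative tending to `0` at infinity** (Cauchy's
estimate on the discs `B(ξ, ‖ξ‖/2)`, on which `g` is holomorphic and uniformly small for `‖ξ‖`
large). [folklore] -/
theorem tendsto_deriv_fst_sub_self (h : IsPencilPlane J u b) (hε : 0 < ε)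
    (hJstd : ∀ x : punctured p, InPuncturedChartBall p ε x →
      ∀ (v : TangentSpace (𝓡 4) x) (c : EuclideanSpace ℝ (Fin 4)),
        inner ℝ (fderiv ℝ inversion (extChartAt (𝓡 4) p x.1 - extChartAt (𝓡 4) p p)
          (mfderiv (𝓡 4) 𝓘(ℝ, EuclideanSpace ℝ (Fin 4))
            (fun z : punctured p => extChartAt (𝓡 4) p z.1) x (J x v))) c
        = stdSymplecticForm (fderiv ℝ inversion (extChartAt (𝓡 4) p x.1 - extChartAt (𝓡 4) p p)
          (mfderiv (𝓡 4) 𝓘(ℝ, EuclideanSpace ℝ (Fin 4))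
            (fun z : punctured p => extChartAt (𝓡 4) p z.1) x v)) c) :
    Tendsto (fun ξ : ℂ => deriv (fun η : ℂ => (pencilCoord p (u η)).1 - η) ξ) (cocompact ℂ) (𝓝 0) := by
  obtain ⟨R, hD, -⟩ := h.exists_differentiableOn_pencilCoord hε hJstd
  have hgD : ∀ ξ : ℂ, R ≤ ‖ξ‖ → DifferentiableAt ℂ (fun η : ℂ => (pencilCoord p (u η)).1 - η) ξ :=
    fun ξ hξ => (hD ξ hξ).fst.fun_sub differentiableAt_id
  rw [Metric.tendsto_nhds]
  intro δ hδ
  have hsmall : ∀ᶠ η in cocompact ℂ, ‖(pencilCoord p (u η)).1 - η‖ < δ / 8 := by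
    have := (Metric.tendsto_nhds.1 h.tendsto_fst_sub) (δ / 8) (by positivity)
    simpa [dist_zero_right] using this
  obtain ⟨R', hR'⟩ := exists_forall_norm_le_of_eventually_cocompact hsmall
  refine eventually_cocompact_of_forall_norm_le (T := max (2 * R') (2 * |R| + 2)) fun ξ hξ => ?_
  have hξR' : 2 * R' ≤ ‖ξ‖ := le_trans (le_max_left _ _) hξ
  have hξR : 2 * |R| + 2 ≤ ‖ξ‖ := le_trans (le_max_right _ _) hξ
  have hRabs : R ≤ |R| := le_abs_self R
  have habs : 0 ≤ |R| := abs_nonneg R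
  -- points of the disc `B(ξ, ‖ξ‖/2)` have norm at least `‖ξ‖/2`
  have hball : ∀ η ∈ Metric.ball ξ (‖ξ‖ / 2), ‖ξ‖ / 2 ≤ ‖η‖ := fun η hη => by
    have h1 : ‖η - ξ‖ < ‖ξ‖ / 2 := by rwa [← dist_eq_norm]
    have h2 : ‖ξ‖ - ‖η‖ ≤ ‖ξ - η‖ := norm_sub_norm_le ξ η
    rw [norm_sub_rev] at h2
    linarith
  have hsub : DifferentiableOn ℂ (fun η : ℂ => (pencilCoord p (u η)).1 - η)
      (Metric.ball ξ (‖ξ‖ / 2)) :=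
    fun η hη => (hgD η (by linarith [hball η hη])).differentiableWithinAt
  have hmaps : MapsTo (fun η : ℂ => (pencilCoord p (u η)).1 - η) (Metric.ball ξ (‖ξ‖ / 2))
      (Metric.closedBall ((pencilCoord p (u ξ)).1 - ξ) (δ / 4)) := fun η hη => by
    have h1 : ‖(pencilCoord p (u η)).1 - η‖ < δ / 8 := hR' η (by linarith [hball η hη])
    have h2 : ‖(pencilCoord p (u ξ)).1 - ξ‖ < δ / 8 := hR' ξ (by linarith)
    show dist ((pencilCoord p (u η)).1 - η) ((pencilCoord p (u ξ)).1 - ξ) ≤ δ / 4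
    rw [dist_eq_norm]
    linarith [norm_sub_le ((pencilCoord p (u η)).1 - η) ((pencilCoord p (u ξ)).1 - ξ)]
  have hderiv : ‖deriv (fun η : ℂ => (pencilCoord p (u η)).1 - η) ξ‖ ≤ (δ / 4) / (‖ξ‖ / 2) :=
    Complex.norm_deriv_le_div_of_mapsTo_ball hsub hmaps (by linarith)
  have hle : (δ / 4) / (‖ξ‖ / 2) ≤ δ / 2 := by
    rw [div_le_iff₀ (by linarith)]
    nlinarith
  show dist (deriv (fun η : ℂ => (pencilCoord p (u η)).1 - η) ξ) 0 < δ
  rw [dist_zero_right]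
  linarith

/-- **Transversality to the line at infinity.** For a member `u` the derivative of its flat
coordinate `z(u ξ) = (pencilCoord p (u ξ)).1` tends to `1` at infinity: in the chart
`(X, W) = (1/z, w/z)` at the point `q_a` of the line at infinity the compactified curve has
`dX ≠ 0`, i.e. it is immersed at `∞` and transverse to `ℓ∞` (Wendl 2018, Prop. 2.53 (1): the
intersection with the constraint is transverse). [cite: Wendl2018, Prop. 2.53 (1) (m = 1)] -/
theorem tendsto_deriv_fst (h : IsPencilPlane J u b) (hε : 0 < ε)
    (hJstd : ∀ x : punctured p, InPuncturedChartBall p ε x →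
      ∀ (v : TangentSpace (𝓡 4) x) (c : EuclideanSpace ℝ (Fin 4)),
        inner ℝ (fderiv ℝ inversion (extChartAt (𝓡 4) p x.1 - extChartAt (𝓡 4) p p)
          (mfderiv (𝓡 4) 𝓘(ℝ, EuclideanSpace ℝ (Fin 4))
            (fun z : punctured p => extChartAt (𝓡 4) p z.1) x (J x v))) c
        = stdSymplecticForm (fderiv ℝ inversion (extChartAt (𝓡 4) p x.1 - extChartAt (𝓡 4) p p)
          (mfderiv (𝓡 4) 𝓘(ℝ, EuclideanSpace ℝ (Fin 4))
            (fun z : punctured p => extChartAt (𝓡 4) p z.1) x v)) c) :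
    Tendsto (fun ξ : ℂ => deriv (fun η : ℂ => (pencilCoord p (u η)).1) ξ) (cocompact ℂ) (𝓝 1) := by
  obtain ⟨R, hD, -⟩ := h.exists_differentiableOn_pencilCoord hε hJstd
  -- eventually `deriv z = deriv g + 1`
  have hev : ∀ᶠ ξ in cocompact ℂ, deriv (fun η : ℂ => (pencilCoord p (u η)).1) ξ =
      deriv (fun η : ℂ => (pencilCoord p (u η)).1 - η) ξ + 1 := by
    refine eventually_cocompact_of_forall_norm_le (T := R) fun ξ hξ => ?_
    have hz : DifferentiableAt ℂ (fun η : ℂ => (pencilCoord p (u η)).1) ξ := (hD ξ hξ).fst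
    have hfun : (fun η : ℂ => (pencilCoord p (u η)).1) =
        fun η => ((pencilCoord p (u η)).1 - η) + η := by
      funext η; ring
    have hg : DifferentiableAt ℂ (fun η : ℂ => (pencilCoord p (u η)).1 - η) ξ :=
      hz.fun_sub differentiableAt_id
    have hsum : HasDerivAt (fun η : ℂ => ((pencilCoord p (u η)).1 - η) + η)
        (deriv (fun η : ℂ => (pencilCoord p (u η)).1 - η) ξ + 1) ξ :=
      hg.hasDerivAt.add (hasDerivAt_id' ξ)
    conv_lhs => rw [hfun]
    exact hsum.deriv
  have h0 := h.tendsto_deriv_fst_sub_self hε hJstd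
  have h1 : Tendsto (fun ξ : ℂ => deriv (fun η : ℂ => (pencilCoord p (u η)).1 - η) ξ + 1)
      (cocompact ℂ) (𝓝 1) := by
    simpa using h0.add_const 1
  exact h1.congr' (hev.mono fun ξ hξ => hξ.symm)

omit [CompactSpace M] [IsManifold (𝓡 4) ∞ M] in
/-- **The compactified member is immersed at `q_a` and transverse to the line at infinity**: in the
parameter `η = 1/ξ` at `∞ ∈ S²` and the coordinate `X = 1/z` transverse to `ℓ∞ = {X = 0}` at
`q_a`, the function `X(û(η)) = 1 / z(u(η⁻¹))` (value `0` at `η = 0`, i.e. `û(∞) = q_a`) has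
complex derivative `1` at `η = 0`. Purely from the asymptotics `z(u ξ) − ξ → 0`.
[cite: Wendl2018, Prop. 2.53 (1) (m = 1)] -/
theorem hasDerivAt_inv_fst_zero (h : IsPencilPlane J u b) :
    HasDerivAt (fun η : ℂ => if η = 0 then (0 : ℂ) else ((pencilCoord p (u η⁻¹)).1)⁻¹) 1 0 := by
  rw [hasDerivAt_iff_tendsto_slope]
  have hinv : Tendsto (fun η : ℂ => η⁻¹) (𝓝[≠] (0 : ℂ)) (cocompact ℂ) := by
    rw [← Metric.cobounded_eq_cocompact]
    exact Filter.tendsto_inv₀_nhdsNE_zero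
  have h1 : Tendsto (fun η : ℂ => ((pencilCoord p (u η⁻¹)).1 / η⁻¹)⁻¹) (𝓝[≠] (0 : ℂ)) (𝓝 1) := by
    have := (h.tendsto_fst_div_self.comp hinv).inv₀ one_ne_zero
    simpa using this
  refine h1.congr' ?_
  filter_upwards [self_mem_nhdsWithin] with η hη
  have hη0 : η ≠ 0 := hη
  rw [slope_def_field]
  simp only [if_neg hη0, if_true, sub_zero]
  field_simp

omit [CompactSpace M] [IsManifold (𝓡 4) ∞ M] in
/-- **The tangent direction at `q_a` is the intercept**: the second compactifying coordinate
`W(û(η)) = w(u(η⁻¹)) / z(u(η⁻¹))` (value `0` at `η = 0`) has complex derivative `b` at `η = 0`, so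
`dû(∞) = (X', W') = (1, b)`: the compactified member is tangent at `q_a` to the line `{w = b}`.
Purely from the asymptotics `z(u ξ) − ξ → 0`, `w(u ξ) → b`. [cite: Wendl2018, Prop. 2.53 (m = 1)] -/
theorem hasDerivAt_snd_div_fst_zero (h : IsPencilPlane J u b) :
    HasDerivAt (fun η : ℂ => if η = 0 then (0 : ℂ)
      else (pencilCoord p (u η⁻¹)).2 / (pencilCoord p (u η⁻¹)).1) b 0 := by
  rw [hasDerivAt_iff_tendsto_slope]
  have hinv : Tendsto (fun η : ℂ => η⁻¹) (𝓝[≠] (0 : ℂ)) (cocompact ℂ) := by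
    rw [← Metric.cobounded_eq_cocompact]
    exact Filter.tendsto_inv₀_nhdsNE_zero
  have h1 : Tendsto (fun η : ℂ => (pencilCoord p (u η⁻¹)).2 * ((pencilCoord p (u η⁻¹)).1 / η⁻¹)⁻¹)
      (𝓝[≠] (0 : ℂ)) (𝓝 b) := by
    have hz := (h.tendsto_fst_div_self.comp hinv).inv₀ one_ne_zero
    have hw := h.tendsto_snd.comp hinv
    simpa using hw.mul hz
  refine h1.congr' ?_
  filter_upwards [self_mem_nhdsWithin] with η hη
  have hη0 : η ≠ 0 := hη
  rw [slope_def_field]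
  simp only [if_neg hη0, if_true, sub_zero]
  field_simp

/-- **Holomorphy of the compactification at `q_a`.** For `J` standard on the punctured `ε`-ball,
the two compactifying coordinates `X(û(η)) = 1/z(u(η⁻¹))` and `W(û(η)) = w(u(η⁻¹))/z(u(η⁻¹))`
(values `0` at `η = 0`) are complex differentiable on a whole disc about `η = 0`: the member extends
holomorphically over `∞` through `q_a` (removable singularity — here obtained directly from the
derivative at `0` and holomorphy in the end). [cite: Wendl2018, Prop. 2.53 (proof sketch, p. 65)] -/
theorem exists_differentiableOn_compactification (h : IsPencilPlane J u b) (hε : 0 < ε)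
    (hJstd : ∀ x : punctured p, InPuncturedChartBall p ε x →
      ∀ (v : TangentSpace (𝓡 4) x) (c : EuclideanSpace ℝ (Fin 4)),
        inner ℝ (fderiv ℝ inversion (extChartAt (𝓡 4) p x.1 - extChartAt (𝓡 4) p p)
          (mfderiv (𝓡 4) 𝓘(ℝ, EuclideanSpace ℝ (Fin 4))
            (fun z : punctured p => extChartAt (𝓡 4) p z.1) x (J x v))) c
        = stdSymplecticForm (fderiv ℝ inversion (extChartAt (𝓡 4) p x.1 - extChartAt (𝓡 4) p p)
          (mfderiv (𝓡 4) 𝓘(ℝ, EuclideanSpace ℝ (Fin 4))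
            (fun z : punctured p => extChartAt (𝓡 4) p z.1) x v)) c) :
    ∃ r : ℝ, 0 < r ∧
      DifferentiableOn ℂ (fun η : ℂ => if η = 0 then (0 : ℂ) else ((pencilCoord p (u η⁻¹)).1)⁻¹)
        (Metric.ball 0 r) ∧
      DifferentiableOn ℂ (fun η : ℂ => if η = 0 then (0 : ℂ)
        else (pencilCoord p (u η⁻¹)).2 / (pencilCoord p (u η⁻¹)).1) (Metric.ball 0 r) := by
  obtain ⟨R, hD, -⟩ := h.exists_differentiableOn_pencilCoord hε hJstd
  -- `z(u ξ) ≠ 0` for `‖ξ‖` large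
  obtain ⟨R₁, hR₁⟩ := exists_forall_norm_le_of_eventually_cocompact
    (h.tendsto_norm_fst.eventually_ge_atTop 1)
  set T : ℝ := max (max R R₁) 1 with hT
  have hTpos : 0 < T := lt_of_lt_of_le one_pos (le_max_right _ _)
  -- for `0 < ‖η‖ < T⁻¹`: `η⁻¹` is in the holomorphy region and `z(u η⁻¹) ≠ 0`
  have key : ∀ η : ℂ, η ∈ Metric.ball (0 : ℂ) T⁻¹ → η ≠ 0 →
      DifferentiableAt ℂ (fun ξ : ℂ => pencilCoord p (u ξ)) η⁻¹ ∧ (pencilCoord p (u η⁻¹)).1 ≠ 0 := by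
    intro η hη hη0
    have hηn : ‖η‖ < T⁻¹ := by simpa using hη
    have hηinv : T < ‖η⁻¹‖ := by
      rw [norm_inv]; rwa [lt_inv_comm₀ hTpos (norm_pos_iff.2 hη0)]
    have hR : R ≤ ‖η⁻¹‖ := ((le_max_left _ _).trans (le_max_left _ _)).trans hηinv.le
    have hR₁' : R₁ ≤ ‖η⁻¹‖ := ((le_max_right _ _).trans (le_max_left _ _)).trans hηinv.le
    refine ⟨hD _ hR, ?_⟩
    have := hR₁ _ hR₁'
    exact norm_pos_iff.1 (lt_of_lt_of_le one_pos this)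
  refine ⟨T⁻¹, inv_pos.2 hTpos, ?_, ?_⟩
  · intro η hη
    by_cases hη0 : η = 0
    · subst hη0
      exact h.hasDerivAt_inv_fst_zero.differentiableAt.differentiableWithinAt
    · obtain ⟨hzw, hne⟩ := key η hη hη0
      have hcomp : DifferentiableAt ℂ (fun η : ℂ => ((pencilCoord p (u η⁻¹)).1)⁻¹) η :=
        ((hzw.fst.comp η (differentiableAt_inv hη0)).inv hne)
      refine (hcomp.congr_of_eventuallyEq ?_).differentiableWithinAt
      filter_upwards [isOpen_compl_singleton.mem_nhds hη0] with θ hθ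
      simp only [Set.mem_compl_iff, Set.mem_singleton_iff] at hθ
      simp [hθ]
  · intro η hη
    by_cases hη0 : η = 0
    · subst hη0
      exact h.hasDerivAt_snd_div_fst_zero.differentiableAt.differentiableWithinAt
    · obtain ⟨hzw, hne⟩ := key η hη hη0
      have hcomp : DifferentiableAt ℂ
          (fun η : ℂ => (pencilCoord p (u η⁻¹)).2 / (pencilCoord p (u η⁻¹)).1) η :=
        ((hzw.comp η (differentiableAt_inv hη0)).snd.div
          (hzw.comp η (differentiableAt_inv hη0)).fst hne)
      refine (hcomp.congr_of_eventuallyEq ?_).differentiableWithinAt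
      filter_upwards [isOpen_compl_singleton.mem_nhds hη0] with θ hθ
      simp only [Set.mem_compl_iff, Set.mem_singleton_iff] at hθ
      simp [hθ]

/-! ### §5 The graph normal form near infinity: `w = H(z)` with `H` holomorphic, `H(∞) = b` -/

/-- **A good radius.** Outside a ball the correction `g(ξ) = z(u ξ) − ξ` is holomorphic with
`‖g‖ ≤ 1/4` and `‖g'‖ ≤ 1/2` (from `g → 0`, `g' → 0` and holomorphy in the end). [folklore] -/
theorem exists_good_radius (h : IsPencilPlane J u b) (hε : 0 < ε)
    (hJstd : ∀ x : punctured p, InPuncturedChartBall p ε x →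
      ∀ (v : TangentSpace (𝓡 4) x) (c : EuclideanSpace ℝ (Fin 4)),
        inner ℝ (fderiv ℝ inversion (extChartAt (𝓡 4) p x.1 - extChartAt (𝓡 4) p p)
          (mfderiv (𝓡 4) 𝓘(ℝ, EuclideanSpace ℝ (Fin 4))
            (fun z : punctured p => extChartAt (𝓡 4) p z.1) x (J x v))) c
        = stdSymplecticForm (fderiv ℝ inversion (extChartAt (𝓡 4) p x.1 - extChartAt (𝓡 4) p p)
          (mfderiv (𝓡 4) 𝓘(ℝ, EuclideanSpace ℝ (Fin 4))
            (fun z : punctured p => extChartAt (𝓡 4) p z.1) x v)) c) :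
    ∃ R : ℝ, 0 < R ∧ ∀ ξ : ℂ, R ≤ ‖ξ‖ →
      InPuncturedChartBall p ε (u ξ) ∧
      DifferentiableAt ℂ (fun η : ℂ => pencilCoord p (u η)) ξ ∧
      DifferentiableAt ℂ (fun η : ℂ => (pencilCoord p (u η)).1 - η) ξ ∧
      ‖(pencilCoord p (u ξ)).1 - ξ‖ ≤ 1 / 4 ∧
      ‖deriv (fun η : ℂ => (pencilCoord p (u η)).1 - η) ξ‖ ≤ 1 / 2 := by
  obtain ⟨R₀, hD, -⟩ := h.exists_differentiableOn_pencilCoord hε hJstd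
  have e1 : ∀ᶠ ξ in cocompact ℂ, ‖(pencilCoord p (u ξ)).1 - ξ‖ ≤ 1 / 4 := by
    have := (Metric.tendsto_nhds.1 h.tendsto_fst_sub) (1 / 4) (by norm_num)
    filter_upwards [this] with ξ hξ
    rw [dist_zero_right] at hξ
    exact hξ.le
  have e2 : ∀ᶠ ξ in cocompact ℂ, ‖deriv (fun η : ℂ => (pencilCoord p (u η)).1 - η) ξ‖ ≤ 1 / 2 := by
    have := (Metric.tendsto_nhds.1 (h.tendsto_deriv_fst_sub_self hε hJstd)) (1 / 2) (by norm_num)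
    filter_upwards [this] with ξ hξ
    rw [dist_zero_right] at hξ
    exact hξ.le
  have e3 : ∀ᶠ ξ in cocompact ℂ, R₀ ≤ ‖ξ‖ := eventually_cocompact_of_forall_norm_le fun ξ hξ => hξ
  have e4 : ∀ᶠ ξ in cocompact ℂ, InPuncturedChartBall p ε (u ξ) := h.eventually_inPuncturedChartBall hε
  obtain ⟨R₁, hR₁⟩ := exists_forall_norm_le_of_eventually_cocompact (((e1.and e2).and e3).and e4)
  refine ⟨max R₁ 1, lt_of_lt_of_le one_pos (le_max_right _ _), fun ξ hξ => ?_⟩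
  obtain ⟨⟨⟨h1, h2⟩, h3⟩, h4⟩ := hR₁ ξ ((le_max_left _ _).trans hξ)
  exact ⟨h4, hD ξ h3, (hD ξ h3).fst.fun_sub differentiableAt_id, h1, h2⟩

omit [CompactSpace M] [IsManifold (𝓡 4) ∞ M] in
/-- **Mean-value estimate for the correction** on discs of radius `2` inside the good region:
`‖g ξ₂ − g ξ₁‖ ≤ ‖ξ₂ − ξ₁‖ / 2`. [folklore] -/
theorem norm_sub_sub_le_half {R : ℝ}
    (hR : ∀ ξ : ℂ, R ≤ ‖ξ‖ →
      DifferentiableAt ℂ (fun η : ℂ => (pencilCoord p (u η)).1 - η) ξ ∧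
      ‖deriv (fun η : ℂ => (pencilCoord p (u η)).1 - η) ξ‖ ≤ 1 / 2)
    {ξ₁ ξ₂ : ℂ} (h₁ : R + 2 ≤ ‖ξ₁‖) (h₁₂ : ‖ξ₂ - ξ₁‖ ≤ 2) :
    ‖((pencilCoord p (u ξ₂)).1 - ξ₂) - ((pencilCoord p (u ξ₁)).1 - ξ₁)‖ ≤ 1 / 2 * ‖ξ₂ - ξ₁‖ := by
  have hball : ∀ η ∈ Metric.closedBall ξ₁ 2, R ≤ ‖η‖ := fun η hη => by
    have h1 : ‖η - ξ₁‖ ≤ 2 := by rwa [← dist_eq_norm]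
    have h2 : ‖ξ₁‖ - ‖η‖ ≤ ‖ξ₁ - η‖ := norm_sub_norm_le ξ₁ η
    rw [norm_sub_rev] at h2
    linarith
  exact (convex_closedBall ξ₁ 2).norm_image_sub_le_of_norm_deriv_le
    (fun η hη => (hR η (hball η hη)).1) (fun η hη => (hR η (hball η hη)).2)
    (Metric.mem_closedBall_self (by norm_num)) (by rwa [Metric.mem_closedBall, dist_eq_norm])

omit [CompactSpace M] [IsManifold (𝓡 4) ∞ M] in
/-- **Injectivity of `z ∘ u` near infinity.** If on `{R ≤ ‖ξ‖}` the correction `g = z ∘ u − id`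
is holomorphic with `‖g‖ ≤ 1/4`, `‖g'‖ ≤ 1/2`, then `z ∘ u` is injective on `{R + 2 ≤ ‖ξ‖}`:
`z ξ₁ = z ξ₂` forces `‖ξ₁ − ξ₂‖ ≤ 1/2`, and then the mean-value estimate gives
`‖ξ₁ − ξ₂‖ ≤ ‖ξ₁ − ξ₂‖ / 2`. [folklore] -/
theorem injOn_fst_of_good_radius {R : ℝ}
    (hR : ∀ ξ : ℂ, R ≤ ‖ξ‖ →
      DifferentiableAt ℂ (fun η : ℂ => (pencilCoord p (u η)).1 - η) ξ ∧
      ‖(pencilCoord p (u ξ)).1 - ξ‖ ≤ 1 / 4 ∧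
      ‖deriv (fun η : ℂ => (pencilCoord p (u η)).1 - η) ξ‖ ≤ 1 / 2) :
    InjOn (fun ξ : ℂ => (pencilCoord p (u ξ)).1) {ξ : ℂ | R + 2 ≤ ‖ξ‖} := by
  intro ξ₁ h₁ ξ₂ h₂ heq
  have h₁' : R + 2 ≤ ‖ξ₁‖ := h₁
  have h₂' : R + 2 ≤ ‖ξ₂‖ := h₂
  have heq' : (pencilCoord p (u ξ₁)).1 = (pencilCoord p (u ξ₂)).1 := heq
  -- `ξ₂ - ξ₁ = g ξ₁ - g ξ₂`
  have hdiff : ξ₂ - ξ₁ = ((pencilCoord p (u ξ₁)).1 - ξ₁) - ((pencilCoord p (u ξ₂)).1 - ξ₂) := by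
    rw [heq']; ring
  have hsmall : ‖ξ₂ - ξ₁‖ ≤ 2 := by
    rw [hdiff]
    have := norm_sub_le ((pencilCoord p (u ξ₁)).1 - ξ₁) ((pencilCoord p (u ξ₂)).1 - ξ₂)
    linarith [(hR ξ₁ (by linarith)).2.1, (hR ξ₂ (by linarith)).2.1]
  have hmv := norm_sub_sub_le_half (fun ξ hξ => ⟨(hR ξ hξ).1, (hR ξ hξ).2.2⟩) h₁' hsmall
  have hkey : ‖ξ₂ - ξ₁‖ ≤ 1 / 2 * ‖ξ₂ - ξ₁‖ := by
    calc ‖ξ₂ - ξ₁‖ = ‖((pencilCoord p (u ξ₂)).1 - ξ₂) - ((pencilCoord p (u ξ₁)).1 - ξ₁)‖ := by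
          rw [hdiff, norm_sub_rev]
      _ ≤ 1 / 2 * ‖ξ₂ - ξ₁‖ := hmv
  have h0 : ‖ξ₂ - ξ₁‖ = 0 := by linarith [norm_nonneg (ξ₂ - ξ₁)]
  exact (sub_eq_zero.1 (norm_eq_zero.1 h0)).symm

/-- **`z ∘ u` is injective near infinity** (a member is eventually a graph over the `z`-plane).
[cite: Gromov1985, 2.4.A'] -/
theorem exists_injOn_fst (h : IsPencilPlane J u b) (hε : 0 < ε)
    (hJstd : ∀ x : punctured p, InPuncturedChartBall p ε x →
      ∀ (v : TangentSpace (𝓡 4) x) (c : EuclideanSpace ℝ (Fin 4)),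
        inner ℝ (fderiv ℝ inversion (extChartAt (𝓡 4) p x.1 - extChartAt (𝓡 4) p p)
          (mfderiv (𝓡 4) 𝓘(ℝ, EuclideanSpace ℝ (Fin 4))
            (fun z : punctured p => extChartAt (𝓡 4) p z.1) x (J x v))) c
        = stdSymplecticForm (fderiv ℝ inversion (extChartAt (𝓡 4) p x.1 - extChartAt (𝓡 4) p p)
          (mfderiv (𝓡 4) 𝓘(ℝ, EuclideanSpace ℝ (Fin 4))
            (fun z : punctured p => extChartAt (𝓡 4) p z.1) x v)) c) :
    ∃ R : ℝ, InjOn (fun ξ : ℂ => (pencilCoord p (u ξ)).1) {ξ : ℂ | R ≤ ‖ξ‖} := by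
  obtain ⟨R, -, hR⟩ := h.exists_good_radius hε hJstd
  exact ⟨R + 2, injOn_fst_of_good_radius fun ξ hξ => ⟨(hR ξ hξ).2.2.1, (hR ξ hξ).2.2.2⟩⟩

omit [CompactSpace M] [IsManifold (𝓡 4) ∞ M] in
/-- **Every far vertical line meets the member**: under the good-radius hypotheses, for
`‖z₀‖ ≥ R + 3` there is `ξ` with `‖ξ‖ ≥ R + 2` and `z(u ξ) = z₀` — the fixed point of the
contraction `ξ ↦ z₀ − g ξ` of the closed unit disc about `z₀` (Banach). [folklore] -/
theorem exists_fst_eq_of_good_radius {R : ℝ}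
    (hR : ∀ ξ : ℂ, R ≤ ‖ξ‖ →
      DifferentiableAt ℂ (fun η : ℂ => (pencilCoord p (u η)).1 - η) ξ ∧
      ‖(pencilCoord p (u ξ)).1 - ξ‖ ≤ 1 / 4 ∧
      ‖deriv (fun η : ℂ => (pencilCoord p (u η)).1 - η) ξ‖ ≤ 1 / 2)
    {z₀ : ℂ} (hz₀ : R + 3 ≤ ‖z₀‖) :
    ∃ ξ : ℂ, R + 2 ≤ ‖ξ‖ ∧ ‖ξ - z₀‖ ≤ 1 ∧ (pencilCoord p (u ξ)).1 = z₀ := by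
  set S : Set ℂ := Metric.closedBall z₀ 1 with hS
  set F : ℂ → ℂ := fun ξ => z₀ - ((pencilCoord p (u ξ)).1 - ξ) with hF
  have hSnorm : ∀ ξ ∈ S, R + 2 ≤ ‖ξ‖ := fun ξ hξ => by
    have h1 : ‖ξ - z₀‖ ≤ 1 := by rwa [← dist_eq_norm]
    have h2 : ‖z₀‖ - ‖ξ‖ ≤ ‖z₀ - ξ‖ := norm_sub_norm_le z₀ ξ
    rw [norm_sub_rev] at h2
    linarith
  have hmaps : MapsTo F S S := fun ξ hξ => by
    show dist (F ξ) z₀ ≤ 1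
    rw [dist_eq_norm]
    have : F ξ - z₀ = -((pencilCoord p (u ξ)).1 - ξ) := by simp [hF]
    rw [this, norm_neg]
    linarith [(hR ξ (by linarith [hSnorm ξ hξ])).2.1]
  have hdF : ∀ ξ ∈ S, DifferentiableAt ℂ F ξ := fun ξ hξ =>
    (hR ξ (by linarith [hSnorm ξ hξ])).1.const_sub z₀
  have hbound : ∀ ξ ∈ S, ‖deriv F ξ‖₊ ≤ (1 / 2 : NNReal) := fun ξ hξ => by
    have hd : deriv F ξ = -deriv (fun η : ℂ => (pencilCoord p (u η)).1 - η) ξ := by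
      simp only [hF]
      exact deriv_const_sub z₀
    have hr : ‖deriv F ξ‖ ≤ 1 / 2 := by
      rw [hd, norm_neg]
      exact (hR ξ (by linarith [hSnorm ξ hξ])).2.2
    have : ((‖deriv F ξ‖₊ : NNReal) : ℝ) ≤ ((1 / 2 : NNReal) : ℝ) := by
      rw [coe_nnnorm]; norm_num; exact hr
    exact NNReal.coe_le_coe.1 this
  have hLip : LipschitzOnWith (1 / 2 : NNReal) F S :=
    (convex_closedBall z₀ 1).lipschitzOnWith_of_nnnorm_deriv_le hdF hbound
  have hcontr : ContractingWith (1 / 2 : NNReal) (hmaps.restrict F S S) :=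
    ⟨by rw [← NNReal.coe_lt_coe]; norm_num, (hmaps.lipschitzOnWith_iff_restrict).1 hLip⟩
  have hsc : IsComplete S := (Metric.isClosed_closedBall).isComplete
  obtain ⟨ξ, hξS, hfix, -⟩ := hcontr.exists_fixedPoint' hsc hmaps
    (Metric.mem_closedBall_self zero_le_one) (edist_ne_top _ _)
  refine ⟨ξ, hSnorm ξ hξS, by rwa [← dist_eq_norm], ?_⟩
  have hfix' : F ξ = ξ := hfix
  simp only [hF] at hfix'
  linear_combination -hfix'

/-- **The graph normal form near infinity** (Gromov 1985, 2.4.A′; Wendl 2018, p. 65: near the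
constraint point the curves are holomorphic graphs over the `z`-plane). For a member `u` of
intercept `b` there are `R` and a function `H : ℂ → ℂ`, holomorphic on `{R < ‖z‖}` with
`H(z) → b` as `z → ∞`, such that: on `{R − 1 ≤ ‖ξ‖}` the member lies in the punctured `ε`-ball
and `z ∘ u` is injective there; on `{R + 2 ≤ ‖ξ‖}` it reads `w(u ξ) = H(z(u ξ))` with
`R < ‖z(u ξ)‖`; and every vertical line `{z = z₀}`, `R < ‖z₀‖`, meets `u({R − 1 ≤ ‖ξ‖})`.
(Injectivity of `z ∘ u` by the mean-value inequality, surjectivity by Banach's fixed point theorem,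
holomorphy of the inverse by `HasDerivAt.of_local_left_inverse`.) [cite: Gromov1985, 2.4.A'] -/
theorem exists_graph_normalForm (h : IsPencilPlane J u b) (hε : 0 < ε)
    (hJstd : ∀ x : punctured p, InPuncturedChartBall p ε x →
      ∀ (v : TangentSpace (𝓡 4) x) (c : EuclideanSpace ℝ (Fin 4)),
        inner ℝ (fderiv ℝ inversion (extChartAt (𝓡 4) p x.1 - extChartAt (𝓡 4) p p)
          (mfderiv (𝓡 4) 𝓘(ℝ, EuclideanSpace ℝ (Fin 4))
            (fun z : punctured p => extChartAt (𝓡 4) p z.1) x (J x v))) c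
        = stdSymplecticForm (fderiv ℝ inversion (extChartAt (𝓡 4) p x.1 - extChartAt (𝓡 4) p p)
          (mfderiv (𝓡 4) 𝓘(ℝ, EuclideanSpace ℝ (Fin 4))
            (fun z : punctured p => extChartAt (𝓡 4) p z.1) x v)) c) :
    ∃ (R : ℝ) (H : ℂ → ℂ), 0 < R ∧
      DifferentiableOn ℂ H {z : ℂ | R < ‖z‖} ∧
      Tendsto H (cocompact ℂ) (𝓝 b) ∧
      (∀ ξ : ℂ, R - 1 ≤ ‖ξ‖ → InPuncturedChartBall p ε (u ξ)) ∧
      InjOn (fun ξ : ℂ => (pencilCoord p (u ξ)).1) {ξ : ℂ | R - 1 ≤ ‖ξ‖} ∧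
      (∀ ξ : ℂ, R + 2 ≤ ‖ξ‖ →
        R < ‖(pencilCoord p (u ξ)).1‖ ∧ (pencilCoord p (u ξ)).2 = H ((pencilCoord p (u ξ)).1)) ∧
      (∀ z₀ : ℂ, R < ‖z₀‖ → ∃ ξ : ℂ, R - 1 ≤ ‖ξ‖ ∧ (pencilCoord p (u ξ)).1 = z₀) := by
  obtain ⟨R, hRpos, hR⟩ := h.exists_good_radius hε hJstd
  have hR' : ∀ ξ : ℂ, R ≤ ‖ξ‖ →
      DifferentiableAt ℂ (fun η : ℂ => (pencilCoord p (u η)).1 - η) ξ ∧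
      ‖(pencilCoord p (u ξ)).1 - ξ‖ ≤ 1 / 4 ∧
      ‖deriv (fun η : ℂ => (pencilCoord p (u η)).1 - η) ξ‖ ≤ 1 / 2 :=
    fun ξ hξ => ⟨(hR ξ hξ).2.2.1, (hR ξ hξ).2.2.2.1, (hR ξ hξ).2.2.2.2⟩
  have hinj := injOn_fst_of_good_radius hR'
  -- the inverse `ζ` of `z ∘ u` on `{R + 3 ≤ ‖z₀‖}`
  have hex : ∀ z₀ : ℂ, R + 3 ≤ ‖z₀‖ →
      ∃ ξ : ℂ, R + 2 ≤ ‖ξ‖ ∧ ‖ξ - z₀‖ ≤ 1 ∧ (pencilCoord p (u ξ)).1 = z₀ :=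
    fun z₀ hz₀ => exists_fst_eq_of_good_radius hR' hz₀
  classical
  set ζ : ℂ → ℂ := fun z₀ => if hz : R + 3 ≤ ‖z₀‖ then Classical.choose (hex z₀ hz) else 0 with hζ
  have hζspec : ∀ z₀ : ℂ, R + 3 ≤ ‖z₀‖ →
      R + 2 ≤ ‖ζ z₀‖ ∧ ‖ζ z₀ - z₀‖ ≤ 1 ∧ (pencilCoord p (u (ζ z₀))).1 = z₀ := by
    intro z₀ hz
    have : ζ z₀ = Classical.choose (hex z₀ hz) := by simp [hζ, hz]
    rw [this]
    exact Classical.choose_spec (hex z₀ hz)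
  -- local Lipschitz bound for `ζ`: `‖ζ z₂ - ζ z₁‖ ≤ 2 ‖z₂ - z₁‖` when `‖z₂ - z₁‖ ≤ 1`
  have hζlip : ∀ z₁ z₂ : ℂ, R + 3 ≤ ‖z₁‖ → R + 3 ≤ ‖z₂‖ → ‖z₂ - z₁‖ ≤ 1 →
      ‖ζ z₂ - ζ z₁‖ ≤ 2 * ‖z₂ - z₁‖ := by
    intro z₁ z₂ hz₁ hz₂ h12
    obtain ⟨hn₁, -, he₁⟩ := hζspec z₁ hz₁
    obtain ⟨hn₂, -, he₂⟩ := hζspec z₂ hz₂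
    -- `ζ z₂ - ζ z₁ = (z₂ - z₁) - (g (ζ z₂) - g (ζ z₁))`
    have hid : ζ z₂ - ζ z₁ = (z₂ - z₁) -
        (((pencilCoord p (u (ζ z₂))).1 - ζ z₂) - ((pencilCoord p (u (ζ z₁))).1 - ζ z₁)) := by
      rw [he₁, he₂]; ring
    have hsmall : ‖ζ z₂ - ζ z₁‖ ≤ 2 := by
      rw [hid]
      have := norm_sub_le (z₂ - z₁)
        (((pencilCoord p (u (ζ z₂))).1 - ζ z₂) - ((pencilCoord p (u (ζ z₁))).1 - ζ z₁))
      have := norm_sub_le ((pencilCoord p (u (ζ z₂))).1 - ζ z₂) ((pencilCoord p (u (ζ z₁))).1 - ζ z₁)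
      linarith [(hR' (ζ z₁) (by linarith)).2.1, (hR' (ζ z₂) (by linarith)).2.1]
    have hmv := norm_sub_sub_le_half (fun ξ hξ => ⟨(hR' ξ hξ).1, (hR' ξ hξ).2.2⟩) hn₁ hsmall
    have h1 : ‖ζ z₂ - ζ z₁‖ ≤ ‖z₂ - z₁‖ + 1 / 2 * ‖ζ z₂ - ζ z₁‖ := by
      calc ‖ζ z₂ - ζ z₁‖ = ‖(z₂ - z₁) -
            (((pencilCoord p (u (ζ z₂))).1 - ζ z₂) - ((pencilCoord p (u (ζ z₁))).1 - ζ z₁))‖ := by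
              rw [← hid]
        _ ≤ ‖z₂ - z₁‖ +
            ‖((pencilCoord p (u (ζ z₂))).1 - ζ z₂) - ((pencilCoord p (u (ζ z₁))).1 - ζ z₁)‖ :=
              norm_sub_le _ _
        _ ≤ ‖z₂ - z₁‖ + 1 / 2 * ‖ζ z₂ - ζ z₁‖ := by linarith
    linarith
  have hζcont : ∀ z₀ : ℂ, R + 3 < ‖z₀‖ → ContinuousAt ζ z₀ := by
    intro z₀ hz₀
    rw [Metric.continuousAt_iff]
    intro δ hδ
    refine ⟨min (min 1 (‖z₀‖ - (R + 3))) (δ / 2), by positivity, fun z hz => ?_⟩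
    rw [dist_eq_norm] at hz ⊢
    have hz1 : ‖z - z₀‖ < 1 := lt_of_lt_of_le hz ((min_le_left _ _).trans (min_le_left _ _))
    have hz2 : ‖z - z₀‖ < ‖z₀‖ - (R + 3) :=
      lt_of_lt_of_le hz ((min_le_left _ _).trans (min_le_right _ _))
    have hz3 : ‖z - z₀‖ < δ / 2 := lt_of_lt_of_le hz (min_le_right _ _)
    have hzn : R + 3 ≤ ‖z‖ := by
      have h2 : ‖z₀‖ - ‖z‖ ≤ ‖z₀ - z‖ := norm_sub_norm_le z₀ z
      rw [norm_sub_rev] at h2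
      linarith
    have := hζlip z₀ z hz₀.le hzn hz1.le
    linarith
  -- `ζ` is holomorphic on `{R + 3 < ‖z₀‖}`
  have hζdiff : ∀ z₀ : ℂ, R + 3 < ‖z₀‖ →
      HasDerivAt ζ (deriv (fun η : ℂ => (pencilCoord p (u η)).1) (ζ z₀))⁻¹ z₀ := by
    intro z₀ hz₀
    obtain ⟨hn, -, he⟩ := hζspec z₀ hz₀.le
    have hzd : DifferentiableAt ℂ (fun η : ℂ => (pencilCoord p (u η)).1) (ζ z₀) :=
      (hR (ζ z₀) (by linarith)).2.1.fst
    -- `deriv z = deriv g + 1 ≠ 0`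
    have hderiv_eq : deriv (fun η : ℂ => (pencilCoord p (u η)).1) (ζ z₀) =
        deriv (fun η : ℂ => (pencilCoord p (u η)).1 - η) (ζ z₀) + 1 := by
      have hg : DifferentiableAt ℂ (fun η : ℂ => (pencilCoord p (u η)).1 - η) (ζ z₀) :=
        hzd.fun_sub differentiableAt_id
      have hsum : HasDerivAt (fun η : ℂ => ((pencilCoord p (u η)).1 - η) + η)
          (deriv (fun η : ℂ => (pencilCoord p (u η)).1 - η) (ζ z₀) + 1) (ζ z₀) :=
        hg.hasDerivAt.add (hasDerivAt_id' (ζ z₀))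
      have hfun : (fun η : ℂ => (pencilCoord p (u η)).1) =
          fun η => ((pencilCoord p (u η)).1 - η) + η := by
        funext η; ring
      conv_lhs => rw [hfun]
      exact hsum.deriv
    have hne : deriv (fun η : ℂ => (pencilCoord p (u η)).1) (ζ z₀) ≠ 0 := by
      rw [hderiv_eq]
      intro h0
      have hb := (hR' (ζ z₀) (by linarith)).2.2
      have : ‖deriv (fun η : ℂ => (pencilCoord p (u η)).1 - η) (ζ z₀)‖ = 1 := by
        have h1 : deriv (fun η : ℂ => (pencilCoord p (u η)).1 - η) (ζ z₀) = -1 := by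
          linear_combination h0
        rw [h1, norm_neg, norm_one]
      linarith
    refine HasDerivAt.of_local_left_inverse (hζcont z₀ hz₀) hzd.hasDerivAt hne ?_
    have hopen : IsOpen {z : ℂ | R + 3 < ‖z‖} := isOpen_lt continuous_const continuous_norm
    filter_upwards [hopen.mem_nhds hz₀] with z hz
    exact (hζspec z (le_of_lt hz)).2.2
  -- the graph function `H = w ∘ u ∘ ζ`
  refine ⟨R + 3, fun z₀ => (pencilCoord p (u (ζ z₀))).2, by linarith, ?_, ?_, ?_, ?_, ?_, ?_⟩
  · intro z₀ hz₀
    have hz₀' : R + 3 < ‖z₀‖ := hz₀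
    obtain ⟨hn, -, -⟩ := hζspec z₀ hz₀'.le
    have hw : DifferentiableAt ℂ (fun η : ℂ => (pencilCoord p (u η)).2) (ζ z₀) :=
      (hR (ζ z₀) (by linarith)).2.1.snd
    exact (hw.comp z₀ (hζdiff z₀ hz₀').differentiableAt).differentiableWithinAt
  · -- `H → b`: `ζ` is proper (`‖ζ z₀‖ ≥ ‖z₀‖ - 1`)
    have hζprop : Tendsto ζ (cocompact ℂ) (cocompact ℂ) := by
      rw [← Metric.cobounded_eq_cocompact, ← tendsto_norm_atTop_iff_cobounded,
        Metric.cobounded_eq_cocompact]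
      have h1 : Tendsto (fun z₀ : ℂ => ‖z₀‖ + -1) (cocompact ℂ) atTop :=
        tendsto_atTop_add_const_right _ _ tendsto_norm_cocompact_atTop
      refine tendsto_atTop_mono' _ ?_ h1
      refine eventually_cocompact_of_forall_norm_le (T := R + 3) fun z₀ hz₀ => ?_
      obtain ⟨-, hd, -⟩ := hζspec z₀ hz₀
      have h2 : ‖z₀‖ - ‖ζ z₀‖ ≤ ‖z₀ - ζ z₀‖ := norm_sub_norm_le z₀ (ζ z₀)
      rw [norm_sub_rev] at h2
      linarith
    exact h.tendsto_snd.comp hζprop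
  · intro ξ hξ
    exact (hR ξ (by linarith)).1
  · intro ξ₁ h₁ ξ₂ h₂ heq
    exact hinj (show R + 2 ≤ ‖ξ₁‖ by simp only [Set.mem_setOf_eq] at h₁; linarith)
      (show R + 2 ≤ ‖ξ₂‖ by simp only [Set.mem_setOf_eq] at h₂; linarith) heq
  · intro ξ hξ
    have hg := (hR' ξ (by linarith)).2.1
    have hz : R + 3 < ‖(pencilCoord p (u ξ)).1‖ := by
      have h2 : ‖ξ‖ - ‖(pencilCoord p (u ξ)).1‖ ≤ ‖ξ - (pencilCoord p (u ξ)).1‖ := norm_sub_norm_le _ _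
      rw [norm_sub_rev] at h2
      linarith
    refine ⟨hz, ?_⟩
    show (pencilCoord p (u ξ)).2 = (pencilCoord p (u (ζ ((pencilCoord p (u ξ)).1)))).2
    obtain ⟨h1, -, h3⟩ := hζspec _ hz.le
    have : ζ ((pencilCoord p (u ξ)).1) = ξ :=
      hinj (show R + 2 ≤ ‖ζ ((pencilCoord p (u ξ)).1)‖ from h1) (show R + 2 ≤ ‖ξ‖ by linarith) h3
    rw [this]
  · intro z₀ hz₀
    have hz₀' : R + 3 < ‖z₀‖ := hz₀
    obtain ⟨hn, -, he⟩ := hζspec z₀ hz₀'.le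
    exact ⟨ζ z₀, by linarith, he⟩

/-! ### §6 Far vertical lines meet a member exactly once -/

omit [CompactSpace M] [IsManifold (𝓡 4) ∞ M] in
/-- **A compact subset of `M ∖ {p}` stays away from `p` in the chart**: there is `r > 0` with
`r ≤ ‖e x − e p‖` for every point `x` of the compact set lying in the chart source (continuity
of `e⁻¹` at `e p`, openness of the target, injectivity of `e` on its source). [folklore] -/
theorem _root_.Literature.Geometry.Symplectic.exists_pos_le_norm_extChartAt_sub_of_isCompact
    {K : Set (punctured p)} (hK : IsCompact K) :
    ∃ r : ℝ, 0 < r ∧ ∀ x ∈ K, x.1 ∈ (chartAt (EuclideanSpace ℝ (Fin 4)) p).source →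
      r ≤ ‖extChartAt (𝓡 4) p x.1 - extChartAt (𝓡 4) p p‖ := by
  -- `V = M ∖ K` is an open neighbourhood of `p`
  have hKM : IsCompact (((↑) : punctured p → M) '' K) := hK.image continuous_subtype_val
  have hpV : p ∉ ((↑) : punctured p → M) '' K := by
    rintro ⟨x, -, hx⟩
    exact (mem_punctured.1 x.2) hx
  have hVo : IsOpen ((((↑) : punctured p → M) '' K)ᶜ) := hKM.isClosed.isOpen_compl
  -- continuity of `e.symm` at `e p` and openness of the target
  have hcont := continuousAt_extChartAt_symm (I := 𝓡 4) p
  have hpV' : (extChartAt (𝓡 4) p).symm (extChartAt (𝓡 4) p p) ∈ (((↑) : punctured p → M) '' K)ᶜ := by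
    rw [extChartAt_to_inv]
    exact hpV
  have hev1 : ∀ᶠ y in 𝓝 (extChartAt (𝓡 4) p p),
      (extChartAt (𝓡 4) p).symm y ∈ (((↑) : punctured p → M) '' K)ᶜ :=
    hcont.preimage_mem_nhds (hVo.mem_nhds hpV')
  have hev2 : ∀ᶠ y in 𝓝 (extChartAt (𝓡 4) p p), y ∈ (extChartAt (𝓡 4) p).target :=
    (isOpen_extChartAt_target (I := 𝓡 4) p).mem_nhds (mem_extChartAt_target (I := 𝓡 4) p)
  obtain ⟨r, hr, hball⟩ := Metric.eventually_nhds_iff.1 (hev1.and hev2)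
  refine ⟨r, hr, fun x hxK hxs => ?_⟩
  by_contra hlt
  rw [not_le] at hlt
  have hdist : dist (extChartAt (𝓡 4) p x.1) (extChartAt (𝓡 4) p p) < r := by
    rwa [dist_eq_norm]
  obtain ⟨h1, -⟩ := hball hdist
  have hxs' : x.1 ∈ (extChartAt (𝓡 4) p).source := by rwa [extChartAt_source]
  rw [(extChartAt (𝓡 4) p).left_inv hxs'] at h1
  exact h1 ⟨x, hxK, rfl⟩

omit [CompactSpace M] [IsManifold (𝓡 4) ∞ M] in
/-- On a compact set of parameters whose images lie in the chart source, the flat coordinate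
`z(u ξ)` is bounded (`‖z‖ ≤ ‖ι (e x − e p)‖ = ‖e x − e p‖⁻¹ ≤ r⁻¹`). [folklore] -/
theorem exists_norm_fst_le_of_isCompact (h : IsPencilPlane J u b) {K : Set ℂ} (hK : IsCompact K) :
    ∃ C : ℝ, ∀ ξ ∈ K, (u ξ).1 ∈ (chartAt (EuclideanSpace ℝ (Fin 4)) p).source →
      ‖(pencilCoord p (u ξ)).1‖ ≤ C := by
  obtain ⟨r, hr, hrK⟩ :=
    exists_pos_le_norm_extChartAt_sub_of_isCompact (p := p) (hK.image h.continuous)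
  refine ⟨r⁻¹, fun ξ hξ hsrc => ?_⟩
  have hle := hrK (u ξ) ⟨ξ, hξ, rfl⟩ hsrc
  calc ‖(pencilCoord p (u ξ)).1‖
      ≤ ‖inversion (extChartAt (𝓡 4) p (u ξ).1 - extChartAt (𝓡 4) p p)‖ := by
        rw [pencilCoord_eq_flatCx]; exact norm_flatCx_fst_le _
    _ = ‖extChartAt (𝓡 4) p (u ξ).1 - extChartAt (𝓡 4) p p‖⁻¹ := norm_inversion _
    _ ≤ r⁻¹ := inv_anti₀ hr hle

/-- **Far vertical lines meet a member exactly once** (the count used to read the pencil in the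
end: Gromov 1985, 2.4.A′, "each far line `{z = z₀}` meets the curve in one point"): for `‖z₀‖`
large there is exactly one parameter `ξ` with `u ξ` in the chart at `p` and `z(u ξ) = z₀`.
Points with `u ξ` outside the chart source are excluded because there `pencilCoord` is junk.
[cite: Gromov1985, 2.4.A'] -/
theorem exists_unique_fst_eq (h : IsPencilPlane J u b) (hε : 0 < ε)
    (hJstd : ∀ x : punctured p, InPuncturedChartBall p ε x →
      ∀ (v : TangentSpace (𝓡 4) x) (c : EuclideanSpace ℝ (Fin 4)),
        inner ℝ (fderiv ℝ inversion (extChartAt (𝓡 4) p x.1 - extChartAt (𝓡 4) p p)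
          (mfderiv (𝓡 4) 𝓘(ℝ, EuclideanSpace ℝ (Fin 4))
            (fun z : punctured p => extChartAt (𝓡 4) p z.1) x (J x v))) c
        = stdSymplecticForm (fderiv ℝ inversion (extChartAt (𝓡 4) p x.1 - extChartAt (𝓡 4) p p)
          (mfderiv (𝓡 4) 𝓘(ℝ, EuclideanSpace ℝ (Fin 4))
            (fun z : punctured p => extChartAt (𝓡 4) p z.1) x v)) c) :
    ∃ R₁ : ℝ, ∀ z₀ : ℂ, R₁ < ‖z₀‖ →
      ∃! ξ : ℂ, (u ξ).1 ∈ (chartAt (EuclideanSpace ℝ (Fin 4)) p).source ∧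
        (pencilCoord p (u ξ)).1 = z₀ := by
  obtain ⟨R, H, hRpos, -, -, hball, hinj, -, hsurj⟩ := h.exists_graph_normalForm hε hJstd
  obtain ⟨C, hC⟩ := h.exists_norm_fst_le_of_isCompact (isCompact_closedBall (0 : ℂ) (R - 1))
  refine ⟨max R C, fun z₀ hz₀ => ?_⟩
  have hzR : R < ‖z₀‖ := lt_of_le_of_lt (le_max_left _ _) hz₀
  have hzC : C < ‖z₀‖ := lt_of_le_of_lt (le_max_right _ _) hz₀
  obtain ⟨ξ, hξn, hξe⟩ := hsurj z₀ hzR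
  refine ⟨ξ, ⟨(hball ξ hξn).1, hξe⟩, fun ξ' hξ' => ?_⟩
  obtain ⟨hsrc', he'⟩ := hξ'
  -- `ξ'` cannot be in the disc `‖ξ'‖ ≤ R - 1`, where `‖z(u ξ')‖ ≤ C < ‖z₀‖`
  have hξ'n : R - 1 ≤ ‖ξ'‖ := by
    by_contra hlt
    rw [not_le] at hlt
    have hmem : ξ' ∈ Metric.closedBall (0 : ℂ) (R - 1) := by
      rw [Metric.mem_closedBall, dist_zero_right]; exact hlt.le
    have := hC ξ' hmem hsrc'
    rw [he'] at this
    linarith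
  exact hinj (show R - 1 ≤ ‖ξ'‖ from hξ'n) (show R - 1 ≤ ‖ξ‖ from hξn) (he'.trans hξe.symm)

end IsPencilPlane

end Members

end Literature.Geometry.Symplectic
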